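import Summits.Ventures.WeilGRH.InducedCharacterLocal
import Literature.NumberTheory.LFunctions.WeilExplicitDirichletProofs
import Literature.NumberTheory.LFunctions.GeneralizedRH
import HarnessLib

/-!
# GRH arm (rh-explicit, venture WeilGRH): Weil positivity is MONOTONE under inducing a character

Cell `rh-explicit`, WEIL TRACK — GRH ARM (lit/typing seat weil-grh-5 gen12; settles the arm's
«imprimitive bookkeeping» item as a theorem).

Let `χ` be a Dirichlet character mod `q ≠ 1` (any values, not necessarily primitive) and `q ∣ d`;
write `χ↑d = changeLevel h χ` for the character mod `d` INDUCED by `χ` (Mathlib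
`DirichletCharacter.changeLevel`).  In the tree's normalisation of Weil's functional
(`weilFunctionalChar`: `W_χ = −P_χ + A_{q,a_χ}`, no polar term for `q ≠ 1`), for every `k = g ⋆ g̃`:

  `W_{χ↑pq}(k) − W_χ(k) = (log p) · [ k(0) + Σ_{m ≥ 1} ( (χ(p)/√p)^m k(m log p) + conj(χ(p)/√p)^m k(−m log p) ) ]`

(`weilFunctionalChar_changeLevel_prime_sub`: the prime terms `n = p^m` of `χ` that the induced
character loses, plus the conductor gain `k(0)·log p`; if `p ∣ q` already, `χ(p) = 0` and only the
gain remains), and the bracket has non-negative real part (`re_localEulerForm_nonneg`,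
`InducedCharacterLocal.lean`: the unramified local Euler factor is a Poisson kernel on the critical
line).  Hence, one prime at a time (`induction_on_primes`):

* `re_weilQuadraticChar_le_changeLevel` — `Re Q_χ(g) ≤ Re Q_{χ↑d}(g)` for every test function `g`
  (`q ≠ 1`, `q ∣ d`, `d ≠ 0`);
* `WeilPositivityOnChar.changeLevel`, `WeilPositivityChar.changeLevel` — every rung / full
  positivity passes from `χ` to every character it induces;
* `WeilPositivityOnChar.of_primitiveCharacter` — a rung of a non-principal `χ` follows from the
  same rung of its PRIMITIVE inducing character `χ⋆ = χ.primitiveCharacter` (so per-character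
  certificate tables need primitive characters only);
* `WeilPositivityChar.of_grh_of_ne_one` — `GRH(χ) ⇒ WeilPositivityChar χ` for EVERY non-principal
  `χ` of any modulus (the tree had it for primitive `χ`, `WeilPositivityChar.of_grh`), via
  `GRH(χ) ⇔ GRH(χ⋆)` (`DirichletCharacter.riemannHypothesis_iff_primitiveCharacter_holds`).

NOT covered (and false on the full cone): principal characters (`q = 1` carries the polar term;
`Q_{χ₀ mod d} = Q_ζ − polar + local gains`).  Their fixed-window cells stay with the pseudo-key /
uniform-floor certificates of the arm.

References: the factorisation `L(s, χ↑d) = L(s, χ) ∏_{p ∣ d} (1 − χ(p)p^{−s})` behind the prime-term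
bookkeeping is Davenport, *Multiplicative Number Theory*, ch. 5 (2)–(3) = Mathlib
`DirichletCharacter.LFunction_changeLevel`; the positivity of the local factor is folklore
(Poisson kernel). No definitions; no named facts; standard axioms.
-/

set_option autoImplicit false

noncomputable section

open MeasureTheory Complex
open scoped Real ComplexConjugate ArithmeticFunction.vonMangoldt

namespace Summit.Ventures.WeilGRH

open Literature.NumberTheory.LFunctions DirichletCharacter

/-! ## 1. Values and parity of the induced character -/

section Values

variable {q : ℕ} (χ : DirichletCharacter ℂ q)

/-- On residues prime to `d` the induced character agrees with `χ`. [folklore] -/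
theorem changeLevel_apply_natCast_of_coprime {d : ℕ} (h : q ∣ d) {n : ℕ} (hn : n.Coprime d) :
    changeLevel h χ (n : ZMod d) = χ (n : ZMod q) := by
  have h1 : IsCoprime (n : ℤ) (d : ℤ) := Nat.isCoprime_iff_coprime.mpr hn
  simpa only [Int.cast_natCast] using changeLevel_eq_cast_of_dvd' χ h h1

/-- On residues NOT prime to `d` the induced character vanishes. [folklore] -/
theorem changeLevel_apply_natCast_of_not_coprime {d : ℕ} (h : q ∣ d) {n : ℕ}
    (hn : ¬n.Coprime d) : changeLevel h χ (n : ZMod d) = 0 :=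
  MulChar.map_nonunit _ (mt (ZMod.isUnit_iff_coprime n d).mp hn)

/-- **Inducing at one prime.** For a prime `p`, the character mod `p q` induced by `χ` takes the
value `0` at multiples of `p` and the value `χ(n)` elsewhere (whether or not `p ∣ q`). [folklore] -/
theorem changeLevel_prime_mul_apply_natCast {p : ℕ} (hp : p.Prime) {d : ℕ} (hd : d = p * q)
    (h : q ∣ d) (n : ℕ) :
    changeLevel h χ (n : ZMod d) = if p ∣ n then 0 else χ (n : ZMod q) := by
  subst hd
  split_ifs with hpn
  · refine changeLevel_apply_natCast_of_not_coprime χ h fun hco ↦ ?_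
    have h1 : p ∣ Nat.gcd n (p * q) := Nat.dvd_gcd hpn (dvd_mul_right p q)
    rw [Nat.Coprime.gcd_eq_one hco, Nat.dvd_one] at h1
    exact hp.one_lt.ne' h1
  · by_cases hnq : n.Coprime q
    · have hnp : n.Coprime p := ((Nat.Prime.coprime_iff_not_dvd hp).mpr hpn).symm
      exact changeLevel_apply_natCast_of_coprime χ h (Nat.Coprime.mul_right hnp hnq)
    · rw [changeLevel_apply_natCast_of_not_coprime χ h fun hco ↦
        hnq (Nat.Coprime.coprime_mul_left_right hco),
        MulChar.map_nonunit _ (mt (ZMod.isUnit_iff_coprime n q).mp hnq)]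

/-- The induced character has the same value at `−1`. [folklore] -/
theorem changeLevel_apply_neg_one {d : ℕ} (h : q ∣ d) : changeLevel h χ (-1) = χ (-1) := by
  have h1 : IsCoprime (-1 : ℤ) (d : ℤ) := isCoprime_one_left.neg_left
  simpa using changeLevel_eq_cast_of_dvd' χ h h1

/-- The induced character has the same parity `a_χ`. [folklore] -/
theorem charParity_changeLevel {d : ℕ} (h : q ∣ d) :
    charParity (changeLevel h χ) = charParity χ := by
  have hiff : (changeLevel h χ).Even ↔ χ.Even := by
    simp only [DirichletCharacter.Even, changeLevel_apply_neg_one]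
  by_cases he : χ.Even
  · rw [charParity_of_even he, charParity_of_even (hiff.mpr he)]
  · have he' : ¬(changeLevel h χ).Even := fun h' ↦ he (hiff.mp h')
    simp only [charParity, he, he', if_false]

end Values

/-! ## 2. The functional under inducing at one prime -/

section OnePrime

variable {q : ℕ} (χ : DirichletCharacter ℂ q)

/-- **The lost prime terms.** For a prime `p` and `k` of compact support,
`P_χ(k) − P_{χ↑pq}(k) = (log p) Σ'_{m} ( z^{m+1} k((m+1) log p) + (conj z)^{m+1} k(−(m+1) log p) )`,
`z = χ(p)/√p` (the `n = p^{m+1}` terms; `Λ(p^{m+1}) = log p`).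
[cite: DavenportMNT1980, ch. 5 (2)–(3) (the Euler factors at p ∣ d of an induced character)] -/
theorem weilPrimeTermChar_sub_changeLevel_prime {p : ℕ} (hp : p.Prime) {d : ℕ} (hd : d = p * q)
    (h : q ∣ d) {k : ℝ → ℂ} (hk : HasCompactSupport k) :
    weilPrimeTermChar χ k - weilPrimeTermChar (changeLevel h χ) k =
      (Real.log p : ℂ) * ∑' m : ℕ,
        ((χ (p : ZMod q) / (Real.sqrt p : ℂ)) ^ (m + 1) * k (((m + 1 : ℕ) : ℝ) * Real.log p) +
          conj (χ (p : ZMod q) / (Real.sqrt p : ℂ)) ^ (m + 1) *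
            k (-(((m + 1 : ℕ) : ℝ) * Real.log p))) := by
  -- the difference term by term
  set F : ℕ → ℂ := fun n ↦ if p ∣ n then ((Λ n : ℝ) : ℂ) / (Real.sqrt n : ℂ) *
      (χ (n : ZMod q) * k (Real.log n) + conj (χ (n : ZMod q)) * k (-Real.log n)) else 0 with hFdef
  have hpt : ∀ n : ℕ, ((Λ n : ℝ) : ℂ) / (Real.sqrt n : ℂ) *
        (χ (n : ZMod q) * k (Real.log n) + conj (χ (n : ZMod q)) * k (-Real.log n)) -
      ((Λ n : ℝ) : ℂ) / (Real.sqrt n : ℂ) *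
        (changeLevel h χ (n : ZMod d) * k (Real.log n) +
          conj (changeLevel h χ (n : ZMod d)) * k (-Real.log n)) = F n := by
    intro n
    rw [changeLevel_prime_mul_apply_natCast χ hp hd h n]
    simp only [hFdef]
    split_ifs with hpn
    · simp
    · simp
  unfold weilPrimeTermChar
  rw [← (summable_weilPrimeTermChar χ hk).tsum_sub (summable_weilPrimeTermChar _ hk),
    tsum_congr hpt]
  -- reindex `n = p^(m+1)`
  have hinj : Function.Injective (fun m : ℕ ↦ p ^ (m + 1)) := fun a b hab ↦ by
    have := Nat.pow_right_injective hp.two_le hab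
    simpa using this
  have hsuppF : Function.support F ⊆ Set.range (fun m : ℕ ↦ p ^ (m + 1)) := by
    intro n hn
    rw [Function.mem_support] at hn
    by_cases hpn : p ∣ n
    · have hΛ : Λ n ≠ 0 := by
        intro h0
        apply hn
        simp only [hFdef, if_pos hpn, h0, Complex.ofReal_zero, zero_div, zero_mul]
      obtain ⟨r, e, hr, he, rfl⟩ :=
        (isPrimePow_nat_iff _).mp (ArithmeticFunction.vonMangoldt_ne_zero_iff.mp hΛ)
      have hpr : p = r := (Nat.prime_dvd_prime_iff_eq hp hr).mp (hp.dvd_of_dvd_pow hpn)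
      subst hpr
      exact ⟨e - 1, by simp [Nat.sub_add_cancel he]⟩
    · exact absurd (by simp only [hFdef, if_neg hpn]) hn
  rw [← hinj.tsum_eq hsuppF, ← tsum_mul_left]
  refine tsum_congr fun m ↦ ?_
  have hp0 : (0 : ℝ) ≤ p := Nat.cast_nonneg p
  have hsq : (Real.sqrt ((p : ℝ) ^ (m + 1)) : ℂ) = (Real.sqrt p : ℂ) ^ (m + 1) := by
    -- `√(x^f) = (√x)^f` (cf. `Literature.NumberTheory.Automorphic.real_sqrt_pow`; two lines, not worth the import)
    have h : (p : ℝ) ^ (m + 1) = (Real.sqrt p ^ (m + 1)) ^ 2 := by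
      rw [← pow_mul, mul_comm, pow_mul, Real.sq_sqrt hp0]
    rw [h, Real.sqrt_sq (pow_nonneg (Real.sqrt_nonneg _) _), Complex.ofReal_pow]
  simp only [hFdef, if_pos (dvd_pow_self p (Nat.succ_ne_zero m)),
    ArithmeticFunction.vonMangoldt_apply_pow (Nat.succ_ne_zero m),
    ArithmeticFunction.vonMangoldt_apply_prime hp, Nat.cast_pow, map_pow, Real.log_pow, hsq,
    map_div₀, Complex.conj_ofReal, div_pow]
  ring

/-- The archimedean term gains `k(0)·log p` (conductor `q ↦ p q`, same parity). [folklore] -/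
theorem weilArchTermChar_prime_mul_sub {p : ℕ} (hp : p.Prime) (hq0 : q ≠ 0) (a : ℕ) (k : ℝ → ℂ) :
    weilArchTermChar (p * q) a k - weilArchTermChar q a k = k 0 * (Real.log p : ℂ) := by
  unfold weilArchTermChar
  have h1 : Real.log ((p * q : ℕ) : ℝ) = Real.log p + Real.log q := by
    rw [Nat.cast_mul, Real.log_mul (by exact_mod_cast hp.ne_zero) (by exact_mod_cast hq0)]
  rw [h1]
  push_cast
  ring

/-- **Weil's functional under inducing at one prime.** For `χ` mod `q ≠ 1`, `p` prime, `d = p q` and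
`k` of compact support:
`W_{χ↑d}(k) − W_χ(k) = (log p)·( k(0) + Σ'_{m} ( z^{m+1} k((m+1)log p) + (conj z)^{m+1} k(−(m+1)log p) ) )`,
`z = χ(p)/√p`. [cite: DavenportMNT1980, ch. 5 (2)–(3)] -/
theorem weilFunctionalChar_changeLevel_prime_sub [NeZero q] (hq : q ≠ 1) {p : ℕ} (hp : p.Prime)
    {d : ℕ} (hd : d = p * q) (h : q ∣ d) {k : ℝ → ℂ} (hk : HasCompactSupport k) :
    weilFunctionalChar (changeLevel h χ) k - weilFunctionalChar χ k =
      (Real.log p : ℂ) * (k 0 + ∑' m : ℕ,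
        ((χ (p : ZMod q) / (Real.sqrt p : ℂ)) ^ (m + 1) * k (((m + 1 : ℕ) : ℝ) * Real.log p) +
          conj (χ (p : ZMod q) / (Real.sqrt p : ℂ)) ^ (m + 1) *
            k (-(((m + 1 : ℕ) : ℝ) * Real.log p)))) := by
  have hP := weilPrimeTermChar_sub_changeLevel_prime χ hp hd h hk
  have hA := weilArchTermChar_prime_mul_sub hp (NeZero.ne q) (charParity χ) k
  subst hd
  have hpq1 : p * q ≠ 1 := fun h1 ↦ hq (Nat.eq_one_of_mul_eq_one_left h1)
  unfold weilFunctionalChar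
  rw [if_neg hpq1, if_neg hq, charParity_changeLevel]
  linear_combination hP + hA

/-- **One prime step.** For `χ` mod `q ≠ 1`, `p` prime and `d = p q`:
`Re Q_χ(g) ≤ Re Q_{χ↑d}(g)` for every test function `g`
(`= Re Q_χ(g) + (log p)·Re[local Euler form] ≥ Re Q_χ(g)` by `re_localEulerForm_nonneg` with
`‖χ(p)/√p‖ ≤ 1`). [folklore] -/
theorem re_weilQuadraticChar_le_changeLevel_prime [NeZero q] (hq : q ≠ 1) {p : ℕ} (hp : p.Prime)
    {d : ℕ} (hd : d = p * q) (h : q ∣ d) {g : ℝ → ℂ} (hg : IsWeilTest g) :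
    (weilQuadraticChar χ g).re ≤ (weilQuadraticChar (changeLevel h χ) g).re := by
  have hk : IsWeilTest (weilConv g (weilReflect g)) := hg.weilConv hg.weilReflect
  have hsub := weilFunctionalChar_changeLevel_prime_sub χ hq hp hd h hk.2
  have hz : ‖χ (p : ZMod q) / (Real.sqrt p : ℂ)‖ ≤ 1 := by
    have h1 : ‖χ (p : ZMod q)‖ ≤ 1 := χ.norm_le_one _
    have h2 : (1 : ℝ) ≤ Real.sqrt p := Real.one_le_sqrt.mpr (by exact_mod_cast hp.one_lt.le)
    rw [norm_div, Complex.norm_real, Real.norm_of_nonneg (Real.sqrt_nonneg _)]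
    exact (div_le_one (by linarith)).mpr (h1.trans h2)
  have hlogp : 0 < Real.log p := Real.log_pos (by exact_mod_cast hp.one_lt)
  have hloc := re_localEulerForm_nonneg hg.1.continuous hg.2 hlogp hz
  unfold weilQuadraticChar
  rw [eq_add_of_sub_eq' hsub, Complex.add_re, Complex.re_ofReal_mul]
  nlinarith

end OnePrime

/-! ## 3. General multiples: induction over the primes of `d/q` -/

section General

variable {q : ℕ} [NeZero q] (χ : DirichletCharacter ℂ q)

/-- Induction carrier: for every `m` and every `d = m q ≠ 0`, `Re Q_χ ≤ Re Q_{χ↑d}`. [folklore] -/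
theorem re_weilQuadraticChar_le_changeLevel_aux (hq : q ≠ 1) {g : ℝ → ℂ} (hg : IsWeilTest g)
    (m : ℕ) : ∀ {d : ℕ} [NeZero d] (h : q ∣ d), d = m * q →
      (weilQuadraticChar χ g).re ≤ (weilQuadraticChar (changeLevel h χ) g).re := by
  induction m using induction_on_primes with
  | zero =>
    intro d _ h hd
    exact absurd (by simpa using hd) (NeZero.ne d)
  | one =>
    intro d _ h hd
    obtain rfl : d = q := by simpa using hd
    have h1 : changeLevel h χ = χ := changeLevel_self χ
    rw [h1]
  | prime_mul p a hp ih =>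
    intro d _ h hd
    have ha : a ≠ 0 := by
      rintro rfl
      exact NeZero.ne d (by simpa using hd)
    haveI : NeZero (a * q) := ⟨mul_ne_zero ha (NeZero.ne q)⟩
    have haq : a * q ≠ 1 := fun h1 ↦ hq (Nat.eq_one_of_mul_eq_one_left h1)
    have h' : q ∣ a * q := dvd_mul_left q a
    have h₁ : a * q ∣ d := ⟨p, by rw [hd]; ring⟩
    have step1 := ih h' rfl
    have step2 := re_weilQuadraticChar_le_changeLevel_prime (changeLevel h' χ) haq hp
      (d := d) (by rw [hd]; ring) h₁ hg
    rw [← changeLevel_trans] at step2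
    exact step1.trans step2

/-- **LEVEL-RAISING MONOTONICITY of Weil's hermitian functional.** For `χ` mod `q ≠ 1` (any values)
and `q ∣ d`, `d ≠ 0`: `Re Q_χ(g) ≤ Re Q_{χ↑d}(g)` for every test function `g`, `χ↑d = changeLevel h χ`.
[cite: DavenportMNT1980, ch. 5 (2)–(3) (induced characters); folklore (Poisson-kernel positivity of the local Euler factor)] -/
theorem re_weilQuadraticChar_le_changeLevel (hq : q ≠ 1) {d : ℕ} [NeZero d] (h : q ∣ d)
    {g : ℝ → ℂ} (hg : IsWeilTest g) :
    (weilQuadraticChar χ g).re ≤ (weilQuadraticChar (changeLevel h χ) g).re := by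
  obtain ⟨m, hm⟩ := h
  exact re_weilQuadraticChar_le_changeLevel_aux χ hq hg m _ (by rw [hm, mul_comm])

/-- **Every rung passes to induced characters**: `WeilPositivityOnChar χ t → WeilPositivityOnChar (χ↑d) t`
(`q ≠ 1`, `q ∣ d`, `d ≠ 0`). [folklore] -/
theorem WeilPositivityOnChar.changeLevel (hq : q ≠ 1) {d : ℕ} [NeZero d] (h : q ∣ d) {t : ℝ}
    (hpos : WeilPositivityOnChar χ t) : WeilPositivityOnChar (DirichletCharacter.changeLevel h χ) t :=
  fun g hg hgt ↦ (hpos g hg hgt).trans (re_weilQuadraticChar_le_changeLevel χ hq h hg)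

/-- **Full positivity passes to induced characters**: `WeilPositivityChar χ → WeilPositivityChar (χ↑d)`
(`q ≠ 1`, `q ∣ d`, `d ≠ 0`). [folklore] -/
theorem WeilPositivityChar.changeLevel (hq : q ≠ 1) {d : ℕ} [NeZero d] (h : q ∣ d)
    (hpos : WeilPositivityChar χ) : WeilPositivityChar (DirichletCharacter.changeLevel h χ) :=
  fun g hg ↦ (hpos g hg).trans (re_weilQuadraticChar_le_changeLevel χ hq h hg)

end General

/-! ## 4. Reduction to the primitive character; GRH ⇒ positivity for every non-principal character -/

section Primitive

variable {d : ℕ} [NeZero d] (χ : DirichletCharacter ℂ d)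

/-- **Primitive reduction of the rungs.** For a non-principal `χ` mod `d`, every rung of `χ` follows
from the same rung of its primitive inducing character `χ⋆ = χ.primitiveCharacter`
(`χ = changeLevel _ χ⋆`, Mathlib `changeLevel_primitiveCharacter`). [folklore] -/
theorem WeilPositivityOnChar.of_primitiveCharacter (hχ : χ ≠ 1) {t : ℝ}
    (hpos : WeilPositivityOnChar χ.primitiveCharacter t) : WeilPositivityOnChar χ t := by
  haveI : NeZero χ.conductor := ⟨χ.conductor_ne_zero⟩
  have hc1 : χ.conductor ≠ 1 := fun h1 ↦ hχ (eq_one_iff_conductor_eq_one.mpr h1)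
  have key := WeilPositivityOnChar.changeLevel χ.primitiveCharacter hc1 χ.conductor_dvd_level hpos
  rwa [changeLevel_primitiveCharacter] at key

/-- Same for full positivity: `WeilPositivityChar χ⋆ → WeilPositivityChar χ` (`χ ≠ 1`). [folklore] -/
theorem WeilPositivityChar.of_primitiveCharacter (hχ : χ ≠ 1)
    (hpos : WeilPositivityChar χ.primitiveCharacter) : WeilPositivityChar χ := by
  haveI : NeZero χ.conductor := ⟨χ.conductor_ne_zero⟩
  have hc1 : χ.conductor ≠ 1 := fun h1 ↦ hχ (eq_one_iff_conductor_eq_one.mpr h1)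
  have key := WeilPositivityChar.changeLevel χ.primitiveCharacter hc1 χ.conductor_dvd_level hpos
  rwa [changeLevel_primitiveCharacter] at key

/-- **`GRH(χ) ⇒` Weil positivity on all of `C_c^∞`, for EVERY non-principal `χ` of any modulus**
(imprimitive allowed): `GRH(χ) ⇔ GRH(χ⋆)` (same zeros in the open strip) `⇒ WeilPositivityChar χ⋆`
(Weil's «il faut» for the primitive `χ⋆`, tree `WeilPositivityChar.of_grh`) `⇒ WeilPositivityChar χ`
(level-raising monotonicity).  For the principal character of modulus `d > 1` the statement is
false on the full cone (polar term) and is not claimed.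
[cite: Weil1952FormulesExplicites, the «lemme» p. 262 («il faut»); DavenportMNT1980, ch. 5 (2)–(3)] -/
theorem WeilPositivityChar.of_grh_of_ne_one (hχ : χ ≠ 1) (hGRH : χ.RiemannHypothesis) :
    WeilPositivityChar χ := by
  haveI : NeZero χ.conductor := ⟨χ.conductor_ne_zero⟩
  have hc1 : χ.conductor ≠ 1 := fun h1 ↦ hχ (eq_one_iff_conductor_eq_one.mpr h1)
  have hGRH' : χ.primitiveCharacter.RiemannHypothesis :=
    (DirichletCharacter.riemannHypothesis_iff_primitiveCharacter_holds χ).mp hGRH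
  exact WeilPositivityChar.of_primitiveCharacter χ hχ
    (WeilPositivityChar.of_grh hc1 (primitiveCharacter_isPrimitive χ) hGRH')

/-- Hence under `GRH(χ)` every rung holds, for every non-principal `χ` of any modulus: a certified
FAILURE of a rung of an imprimitive character would refute `GRH` for its primitive inducing
character. [cite: Weil1952FormulesExplicites, the «lemme» p. 262 («il faut»)] -/
theorem WeilPositivityOnChar.of_grh_of_ne_one (hχ : χ ≠ 1) (hGRH : χ.RiemannHypothesis) (t : ℝ) :
    WeilPositivityOnChar χ t :=
  (WeilPositivityChar.of_grh_of_ne_one χ hχ hGRH).on t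

end Primitive

/-! ## 5. Packaged reductions: «every primitive character» ⇒ «every non-principal character»; principal characters -/

section Packaged

/-- **From «every primitive character» to «every non-principal character of every modulus»** at a
fixed window `t`: if the rung `t` holds for every primitive character of every modulus `q ≠ 1`, it
holds for every `χ ≠ 1` of every modulus (apply the hypothesis to `χ⋆ = χ.primitiveCharacter`,
whose modulus is the conductor `≠ 1`, then `of_primitiveCharacter`). [folklore] -/
theorem WeilPositivityOnChar.of_forall_isPrimitive {t : ℝ}
    (h : ∀ (q : ℕ) [NeZero q] (ψ : DirichletCharacter ℂ q), q ≠ 1 → ψ.IsPrimitive → WeilPositivityOnChar ψ t)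
    {d : ℕ} [NeZero d] (χ : DirichletCharacter ℂ d) (hχ : χ ≠ 1) : WeilPositivityOnChar χ t := by
  haveI : NeZero χ.conductor := ⟨χ.conductor_ne_zero⟩
  have hc1 : χ.conductor ≠ 1 := fun h1 ↦ hχ (eq_one_iff_conductor_eq_one.mpr h1)
  exact WeilPositivityOnChar.of_primitiveCharacter χ hχ
    (h χ.conductor χ.primitiveCharacter hc1 (primitiveCharacter_isPrimitive χ))

/-- Same packaging for full positivity. [folklore] -/
theorem WeilPositivityChar.of_forall_isPrimitive
    (h : ∀ (q : ℕ) [NeZero q] (ψ : DirichletCharacter ℂ q), q ≠ 1 → ψ.IsPrimitive → WeilPositivityChar ψ)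
    {d : ℕ} [NeZero d] (χ : DirichletCharacter ℂ d) (hχ : χ ≠ 1) : WeilPositivityChar χ := by
  haveI : NeZero χ.conductor := ⟨χ.conductor_ne_zero⟩
  have hc1 : χ.conductor ≠ 1 := fun h1 ↦ hχ (eq_one_iff_conductor_eq_one.mpr h1)
  exact WeilPositivityChar.of_primitiveCharacter χ hχ
    (h χ.conductor χ.primitiveCharacter hc1 (primitiveCharacter_isPrimitive χ))

/-- **Principal characters: the rung passes UP the divisibility order.**  For `1 < q`, `q ∣ d`,
`d ≠ 0`: the rung `t` of the principal character mod `q` gives the rung `t` of the principal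
character mod `d` (`changeLevel_one`; e.g. `q` the least prime factor of `d`).  (The principal
character as INDUCING from level `1` is excluded: `ζ` carries the polar term.) [folklore] -/
theorem WeilPositivityOnChar.one_of_dvd {q d : ℕ} [NeZero d] (hq : q ≠ 1) (h : q ∣ d) {t : ℝ}
    (hpos : WeilPositivityOnChar (1 : DirichletCharacter ℂ q) t) :
    WeilPositivityOnChar (1 : DirichletCharacter ℂ d) t := by
  haveI : NeZero q := ⟨fun h0 ↦ NeZero.ne d (Nat.eq_zero_of_zero_dvd (h0 ▸ h))⟩
  have key := WeilPositivityOnChar.changeLevel (1 : DirichletCharacter ℂ q) hq h hpos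
  rwa [changeLevel_one] at key

end Packaged

end Summit.Ventures.WeilGRH

end
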